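import Summits.Ventures.HodgeRepro2.T5LevelCoinvariants

/-!
# `K`-invariants of the contragredient = dual of the `K`-invariants (Tier-5 kernel support, p8)

For Mathlib's contragredient `ρ.dual` on `Module.Dual k V` (`g • λ = λ ∘ ρ g⁻¹`), the
`K`-invariant functionals are those constant on `K`-orbits (`mem_invariants_dual_iff`); for
`K`-finite `ρ` in characteristic `0` (smooth `ρ`, compact open `K`) restriction to `V^K` and
extension by the level idempotent `λ ↦ λ ∘ e_K` are inverse linear isomorphisms
`(V^∨)^K ≃ (V^K)^∨` (`dualInvariantsEquiv`), so `dim (V^∨)^K = dim V^K`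
(`finrank_invariants_dual`) and the contragredient of an admissible representation is admissible
(`finiteDimensional_invariants_dual`).  Since the `K`-invariants of the full dual are the
`K`-invariants of the smooth dual (invariant vectors are smooth), this is the sentence «the
`K`-invariants of the contragredient are the dual of the `K`-invariants» of the record.  Nothing
is asserted about any specific group.
-/

namespace Summit.Ventures.HodgeRepro2.T5LevelIdempotentDual

open Summit.Ventures.HodgeRepro2.LevelPositivity Summit.Ventures.HodgeRepro2.T5LevelIdempotent
  Summit.Ventures.HodgeRepro2.T5LevelCoinvariants

variable {G : Type*} [Group G] {k : Type*} [Field k] {V : Type*} [AddCommGroup V] [Module k V]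
  (ρ : Representation k G V) {K : Subgroup G}

/-- A functional is `K`-invariant for the contragredient iff it is constant on `K`-orbits. -/
theorem mem_invariants_dual_iff {l : Module.Dual k V} :
    l ∈ invariants ρ.dual K ↔ ∀ g ∈ K, l ∘ₗ ρ g = l := by
  rw [mem_invariants_iff]
  constructor
  · intro h g hg
    have := h g⁻¹ (K.inv_mem hg)
    rwa [Representation.dual_apply, Module.Dual.transpose_apply, inv_inv] at this
  · intro h g hg
    rw [Representation.dual_apply, Module.Dual.transpose_apply]
    exact h g⁻¹ (K.inv_mem hg)

/-- A `K`-invariant functional factors through `e_K` (`K`-finite `ρ`, characteristic `0`). -/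
theorem apply_levelAverage_of_mem_invariants_dual [CharZero k] (hK : KFinite ρ K)
    {l : Module.Dual k V} (hl : l ∈ invariants ρ.dual K) (v : V) :
    l (levelAverage ρ K v) = l v :=
  apply_levelAverage_of_forall_comp_eq ρ hK l
    (fun κ => (mem_invariants_dual_iff ρ).1 hl κ κ.2) v

/-- Restriction of a `K`-invariant functional to `V^K`. -/
noncomputable def restrictDual (l : invariants ρ.dual K) : Module.Dual k (invariants ρ K) :=
  (l : Module.Dual k V) ∘ₗ (invariants ρ K).subtype

/-- `restrictDual` is restriction. -/
@[simp] theorem restrictDual_apply (l : invariants ρ.dual K) (x : invariants ρ K) :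
    restrictDual ρ l x = (l : Module.Dual k V) x :=
  rfl

/-- `e_K` as a linear map `V → V^K`. -/
noncomputable def levelIdempotentTo [CharZero k] (hK : KFinite ρ K) : V →ₗ[k] invariants ρ K :=
  (levelIdempotent K hK).codRestrict (invariants ρ K)
    (fun v => by haveI := hK v; exact levelAverage_mem_invariants)

/-- `levelIdempotentTo` is `e_K`. -/
@[simp] theorem levelIdempotentTo_apply [CharZero k] (hK : KFinite ρ K) (v : V) :
    (levelIdempotentTo ρ hK v : V) = levelAverage ρ K v :=
  rfl

/-- Extension of a functional on `V^K` to a `K`-invariant functional on `V` by `e_K`. -/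
noncomputable def extendDual [CharZero k] (hK : KFinite ρ K) (μ : Module.Dual k (invariants ρ K)) :
    invariants ρ.dual K :=
  ⟨μ ∘ₗ levelIdempotentTo ρ hK, by
    rw [mem_invariants_dual_iff]
    intro g hg
    refine LinearMap.ext fun v => ?_
    simp only [LinearMap.comp_apply]
    congr 1
    haveI := hK v
    exact Subtype.ext (levelAverage_apply (ρ := ρ) (⟨g, hg⟩ : K))⟩

/-- `extendDual μ v = μ (e_K v)`. -/
@[simp] theorem extendDual_apply [CharZero k] (hK : KFinite ρ K) (μ : Module.Dual k (invariants ρ K))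
    (v : V) : (extendDual ρ hK μ : Module.Dual k V) v = μ (levelIdempotentTo ρ hK v) :=
  rfl

/-- `(V^∨)^K ≃ (V^K)^∨`: restriction to `V^K`, with inverse the extension by `e_K`
(`K`-finite `ρ`, characteristic `0`). -/
noncomputable def dualInvariantsEquiv [CharZero k] (hK : KFinite ρ K) :
    invariants ρ.dual K ≃ₗ[k] Module.Dual k (invariants ρ K) where
  toFun := restrictDual ρ
  invFun := extendDual ρ hK
  map_add' l₁ l₂ := rfl
  map_smul' c l := rfl
  left_inv l := by
    apply Subtype.ext
    refine LinearMap.ext fun v => ?_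
    rw [extendDual_apply, restrictDual_apply, levelIdempotentTo_apply]
    exact apply_levelAverage_of_mem_invariants_dual ρ hK l.2 v
  right_inv μ := by
    refine LinearMap.ext fun x => ?_
    rw [restrictDual_apply, extendDual_apply]
    congr 1
    exact Subtype.ext (levelAverage_of_mem_invariants x.2)

/-- `dualInvariantsEquiv` is restriction. -/
@[simp] theorem dualInvariantsEquiv_apply [CharZero k] (hK : KFinite ρ K) (l : invariants ρ.dual K)
    (x : invariants ρ K) : dualInvariantsEquiv ρ hK l x = (l : Module.Dual k V) x :=
  rfl

/-- `dim (V^∨)^K = dim V^K` (`K`-finite `ρ`, characteristic `0`). -/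
theorem finrank_invariants_dual [CharZero k] (hK : KFinite ρ K) :
    Module.finrank k (invariants ρ.dual K) = Module.finrank k (invariants ρ K) := by
  rw [(dualInvariantsEquiv ρ hK).finrank_eq, Subspace.dual_finrank_eq]

/-- The contragredient of an admissible representation is admissible at `K`
(`K`-finite `ρ`, characteristic `0`). -/
theorem finiteDimensional_invariants_dual [CharZero k] (hK : KFinite ρ K)
    [FiniteDimensional k (invariants ρ K)] : FiniteDimensional k (invariants ρ.dual K) :=
  LinearEquiv.finiteDimensional (dualInvariantsEquiv ρ hK).symm

/-- `(V^∨)^K = 0` iff `V^K = 0` (`K`-finite `ρ`, characteristic `0`). -/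
theorem invariants_dual_eq_bot_iff [CharZero k] (hK : KFinite ρ K) :
    invariants ρ.dual K = ⊥ ↔ invariants ρ K = ⊥ := by
  rw [← Submodule.subsingleton_iff_eq_bot, ← Submodule.subsingleton_iff_eq_bot,
    (dualInvariantsEquiv ρ hK).toEquiv.subsingleton_congr, Module.subsingleton_dual_iff]

end Summit.Ventures.HodgeRepro2.T5LevelIdempotentDual
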